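import Summits.QuantumAdvantage.QuantumAdvantage.Theorems.OddPrimeWalkOddLocalRegister
import Summits.QuantumAdvantage.QuantumAdvantage.Theorems.OddPrimeWalkOddLocalCore

/-!
# Item stmt-QuantumAdvantage-23991 `LocalTwoThirdsLaw` — part 2/4: systems of representatives score `≤ 54`, averaging over systems (S4–S5)

AUTHORED AND PROVED BY THE PLANNER SEAT qa-qnc0-p2 g29 (`HOME/qa-qnc0-p2/line29/LocalTwoThirds23991.lean`, 1082 lines, farm
rc 0 / 0 sorry); landed verbatim (split for the 400-line rule, one-line docstrings added) by qn-prover-3 g18, ask P2-29g.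
Uses the computational core `core4_le` (`OddPrimeWalkOddLocalCore.lean`, `native_decide`).
WHAT THIS IS NOT: separation NOT moved.
-/

namespace Summit.QuantumAdvantage.AdviceFreeQNC0.OddLocal

open Finset Literature.Computability.MetaComplexity

variable {n : ℕ}

/-! ## S4 — systems of representatives score ≤ 54 -/

/-- parity profile of a pattern in block `j`: `E ↦ B_j(s_j, E) mod 2`. -/
def prof (m₀ w c : ℕ) (y : Fin (n + 1) → (Fin n → Bool) → Bool) (j : Fin 4) (sj : Fin n → Bool) :
    Fin 3 → Bool :=
  fun E => decide (Bcnt m₀ w c y j sj E.val % 2 = 1)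

/-- profile code of block `j` under the representative system `P` (base-4 digits = class codes). -/
def pcode (m₀ w c : ℕ) (y : Fin (n + 1) → (Fin n → Bool) → Bool) (j : Fin 4)
    (P : Fin 4 → Fin 3 → Fin n → Bool) : ℕ :=
  ∑ a : Fin 3, enc (prof m₀ w c y j (P j a)) * 4 ^ a.val

/-- the class-game exponent of block `j` in the cell `a`. -/
def exq (j : Fin 4) (a : Fin 4 → Fin 3) : ℕ :=
  2 * (∑ i ∈ univ.filter (fun i : Fin 4 => i < j), (a i).val) +
    ∑ i ∈ univ.filter (fun i : Fin 4 => j < i), (a i).val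

/-- Auxiliary `exq_zero` of the local two-thirds law (planner qa-qnc0-p2 g29, `LocalTwoThirds23991.lean`, verbatim). -/
theorem exq_zero (a : Fin 4 → Fin 3) : exq 0 a = (a 1).val + (a 2).val + (a 3).val := by
  simp [exq, Finset.sum_filter, Fin.sum_univ_four]
/-- Auxiliary `exq_one` of the local two-thirds law (planner qa-qnc0-p2 g29, `LocalTwoThirds23991.lean`, verbatim). -/
theorem exq_one (a : Fin 4 → Fin 3) : exq 1 a = 2 * (a 0).val + (a 2).val + (a 3).val := by
  simp [exq, Finset.sum_filter, Fin.sum_univ_four]; omega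
/-- Auxiliary `exq_two` of the local two-thirds law (planner qa-qnc0-p2 g29, `LocalTwoThirds23991.lean`, verbatim). -/
theorem exq_two (a : Fin 4 → Fin 3) : exq 2 a = 2 * (a 0).val + 2 * (a 1).val + (a 3).val := by
  simp [exq, Finset.sum_filter, Fin.sum_univ_four]; omega
/-- Auxiliary `exq_three` of the local two-thirds law (planner qa-qnc0-p2 g29, `LocalTwoThirds23991.lean`, verbatim). -/
theorem exq_three (a : Fin 4 → Fin 3) : exq 3 a = 2 * (a 0).val + 2 * (a 1).val + 2 * (a 2).val := by
  simp [exq, Finset.sum_filter, Fin.sum_univ_four]; omega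

/-- Auxiliary `xor_decide` of the local two-thirds law (planner qa-qnc0-p2 g29, `LocalTwoThirds23991.lean`, verbatim). -/
theorem xor_decide (x z : ℕ) :
    xor (decide (x % 2 = 1)) (decide (z % 2 = 1)) = decide ((x + z) % 2 = 1) := by
  rcases Nat.mod_two_eq_zero_or_one x with hx | hx <;>
    rcases Nat.mod_two_eq_zero_or_one z with hz | hz <;> simp [Nat.add_mod, hx, hz]

/-- Auxiliary `tr_mod` of the local two-thirds law (planner qa-qnc0-p2 g29, `LocalTwoThirds23991.lean`, verbatim). -/
theorem tr_mod (m x : ℕ) : tr m x = tr (m % 3) x := by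
  have h : (m + (x - 1)) % 3 = (m % 3 + (x - 1)) % 3 := by omega
  unfold tr
  rw [h]

/-- Auxiliary `enc_lt` of the local two-thirds law (planner qa-qnc0-p2 g29, `LocalTwoThirds23991.lean`, verbatim). -/
theorem enc_lt (b : Fin 3 → Bool) : enc b < 4 := by
  unfold enc; split_ifs <;> omega

/-- Auxiliary `prof_even` of the local two-thirds law (planner qa-qnc0-p2 g29, `LocalTwoThirds23991.lean`, verbatim). -/
theorem prof_even (m₀ w c : ℕ) (y : Fin (n + 1) → (Fin n → Bool) → Bool) (j : Fin 4)
    (sj : Fin n → Bool) :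
    (xor (xor (prof m₀ w c y j sj 0) (prof m₀ w c y j sj 1)) (prof m₀ w c y j sj 2)) = false := by
  have h := Bcnt_even m₀ w c y j sj
  unfold prof
  rw [show ((0 : Fin 3).val) = 0 from rfl, show ((1 : Fin 3).val) = 1 from rfl,
    show ((2 : Fin 3).val) = 2 from rfl, xor_decide, xor_decide, h]
  decide

/-- Auxiliary `pcode_lt` of the local two-thirds law (planner qa-qnc0-p2 g29, `LocalTwoThirds23991.lean`, verbatim). -/
theorem pcode_lt (m₀ w c : ℕ) (y : Fin (n + 1) → (Fin n → Bool) → Bool) (j : Fin 4)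
    (P : Fin 4 → Fin 3 → Fin n → Bool) : pcode m₀ w c y j P < 64 := by
  unfold pcode
  rw [Fin.sum_univ_three]
  have h0 := enc_lt (prof m₀ w c y j (P j 0))
  have h1 := enc_lt (prof m₀ w c y j (P j 1))
  have h2 := enc_lt (prof m₀ w c y j (P j 2))
  simp only [Fin.val_zero, Fin.val_one, Fin.val_two, pow_zero, pow_one]
  omega

/-- Auxiliary `dig_pcode` of the local two-thirds law (planner qa-qnc0-p2 g29, `LocalTwoThirds23991.lean`, verbatim). -/
theorem dig_pcode (m₀ w c : ℕ) (y : Fin (n + 1) → (Fin n → Bool) → Bool) (j : Fin 4)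
    (P : Fin 4 → Fin 3 → Fin n → Bool) (b : Fin 3) :
    dig (pcode m₀ w c y j P) b.val = enc (prof m₀ w c y j (P j b)) := by
  unfold pcode dig
  rw [Fin.sum_univ_three]
  have h0 := enc_lt (prof m₀ w c y j (P j 0))
  have h1 := enc_lt (prof m₀ w c y j (P j 1))
  have h2 := enc_lt (prof m₀ w c y j (P j 2))
  fin_cases b <;>
    simp only [Fin.val_zero, Fin.val_one, Fin.val_two, pow_zero, pow_one, Fin.mk_one, Fin.isValue,
      Fin.zero_eta, Fin.reduceFinMk] <;> omega

/-- the win bit of the cell `a` under the system `P` is the class-game bit `win4`. -/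
theorem win_eq_win4 (m₀ w c : ℕ) (hn : 6 * w + 4 * m₀ ≤ n) (y : Fin (n + 1) → (Fin n → Bool) → Bool)
    (hy : Radius y w) (P : Fin 4 → Fin 3 → Fin n → Bool)
    (hP : ∀ i j : Fin 4, ∀ a b : Fin 3, ∀ l : Fin n, inWindow m₀ w l.val → P i a l = P j b l)
    (hcls : ∀ j a, wtSeg m₀ w j (P j a) % 3 = a.val) (a : Fin 4 → Fin 3) :
    ringWinU c y (G m₀ w (fun j => P j (a j))) =
      win4 (pcode m₀ w c y 0 P) (pcode m₀ w c y 1 P) (pcode m₀ w c y 2 P)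
        (enc (prof m₀ w c y 3 (P 3 (a 3)))) (a 0).val (a 1).val (a 2).val (a 3).val := by
  have hWA : WinAgree m₀ w (fun j => P j (a j)) := fun i j l hl => hP i j (a i) (a j) l hl
  rw [ringWinU_G m₀ w c hn y hy _ hWA]
  have key : ∀ j : Fin 4, tr (exq j a) (enc (prof m₀ w c y j (P j (a j)))) =
      decide (Bcnt m₀ w c y j (P j (a j)) (Eexp m₀ w j (fun j => P j (a j))) % 2 = 1) := by
    intro j
    have hm3 : Eexp m₀ w j (fun j => P j (a j)) % 3 = exq j a % 3 :=
      Eexp_mod m₀ w j _ a (fun i => hcls i (a i))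
    rw [tr_mod (exq j a)]
    have ht := tr_enc (prof m₀ w c y j (P j (a j))) (prof_even m₀ w c y j (P j (a j)))
      ⟨exq j a % 3, Nat.mod_lt _ (by norm_num)⟩
    rw [Fin.val_mk] at ht
    rw [ht]
    simp only [prof]
    rw [Bcnt_mod3 m₀ w c y j (P j (a j)) (exq j a % 3) (Eexp m₀ w j fun j => P j (a j))
      (by rw [Nat.mod_mod, hm3])]
  rw [Fin.sum_univ_four, ← xor_decide, ← xor_decide, ← xor_decide, ← key 0, ← key 1, ← key 2, ← key 3,
    exq_zero, exq_one, exq_two, exq_three]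
  simp only [win4, dig_pcode]

/-- Auxiliary `system_le` of the local two-thirds law (planner qa-qnc0-p2 g29, `LocalTwoThirds23991.lean`, verbatim). -/
theorem system_le (m₀ w c : ℕ) (hn : 6 * w + 4 * m₀ ≤ n) (y : Fin (n + 1) → (Fin n → Bool) → Bool)
    (hy : Radius y w) (P : Fin 4 → Fin 3 → Fin n → Bool)
    (hP : ∀ i j : Fin 4, ∀ a b : Fin 3, ∀ l : Fin n, inWindow m₀ w l.val → P i a l = P j b l)
    (hcls : ∀ j a, wtSeg m₀ w j (P j a) % 3 = a.val) :
    (univ.filter fun a : Fin 4 → Fin 3 => ringWinU c y (G m₀ w (fun j => P j (a j))) = true).card ≤ 54 := by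
  classical
  set p0 : Fin 64 := ⟨pcode m₀ w c y 0 P, pcode_lt m₀ w c y 0 P⟩ with hp0
  set p1 : Fin 64 := ⟨pcode m₀ w c y 1 P, pcode_lt m₀ w c y 1 P⟩ with hp1
  set p2 : Fin 64 := ⟨pcode m₀ w c y 2 P, pcode_lt m₀ w c y 2 P⟩ with hp2
  refine le_trans ?_ (core4_le p0 p1 p2)
  rw [card_eq_sum_card_fiberwise (f := fun a : Fin 4 → Fin 3 => a 3)
    (s := univ.filter fun a : Fin 4 → Fin 3 => ringWinU c y (G m₀ w (fun j => P j (a j))) = true)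
    (t := univ) (fun _ _ => mem_coe.mpr (mem_univ _))]
  refine Finset.sum_le_sum fun a3 _ => ?_
  set x₀ : Fin 4 := ⟨enc (prof m₀ w c y 3 (P 3 a3)), enc_lt _⟩ with hx₀
  refine le_trans ?_ (Finset.le_sup (f := fun x : Fin 4 => (univ.filter fun w : Fin 3 × Fin 3 × Fin 3 =>
    win4 p0.val p1.val p2.val x.val w.1.val w.2.1.val w.2.2.val a3.val = true).card) (mem_univ x₀))
  rw [filter_filter]
  refine Finset.card_le_card_of_injOn (fun a : Fin 4 → Fin 3 => (a 0, a 1, a 2)) ?_ ?_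
  · intro a ha
    rw [mem_coe, mem_filter] at ha
    rw [mem_coe, mem_filter]
    refine ⟨mem_univ _, ?_⟩
    obtain ⟨_, hw, h3⟩ := ha
    rw [win_eq_win4 m₀ w c hn y hy P hP hcls a, h3] at hw
    exact hw
  · intro a ha a' ha' h
    simp only [Prod.mk.injEq] at h
    rw [mem_coe, mem_filter] at ha ha'
    funext j
    fin_cases j
    · exact h.1
    · exact h.2.1
    · exact h.2.2
    · show a 3 = a' 3
      rw [ha.2.2, ha'.2.2]

/-! ## S5 — averaging over systems (4-family `config_average`) and the per-window loss -/

/-- double counting: `Σ_{x∈S} #{y ∈ T | R x y} = Σ_{y∈T} #{x ∈ S | R x y}`. -/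
theorem sum_card_filter_comm {α β : Type} (S : Finset α) (T : Finset β) (R : α → β → Prop)
    [∀ x y, Decidable (R x y)] :
    (∑ x ∈ S, (T.filter (R x)).card) = ∑ y ∈ T, (S.filter fun x => R x y).card := by
  simp_rw [Finset.card_filter]
  exact Finset.sum_comm

/-- **averaging over systems of representatives** (4 families × 3 classes): if every system scores
at most `54` bad cells, then `Σ_cells #bad(cell)/#cell ≤ 54`.  Proof: for a uniformly random system the
representative tuple of each cell is uniform on the cell (fibres of `P ↦ (P (j, a j))_j` over the cell are
products over the off-diagonal classes, all of the same size). -/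
theorem average4_le {σ : Type} [DecidableEq σ] (C : Fin 4 → Fin 3 → Finset σ)
    (bad : (Fin 4 → σ) → Prop) [DecidablePred bad] (hne : ∀ j a, (C j a).Nonempty)
    (hsys : ∀ P : Fin 4 → Fin 3 → σ, (∀ j a, P j a ∈ C j a) →
      (univ.filter fun a : Fin 4 → Fin 3 => bad (fun j => P j (a j))).card ≤ 54) :
    (∑ a : Fin 4 → Fin 3, (((Fintype.piFinset fun j => C j (a j)).filter bad).card : ℝ) /
      ∏ j, ((C j (a j)).card : ℝ)) ≤ 54 := by
  classical
  -- systems, uncurried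
  set Sys : Finset (Fin 4 × Fin 3 → σ) := Fintype.piFinset fun p => C p.1 p.2 with hSys
  have hSyscard : Sys.card = ∏ p : Fin 4 × Fin 3, (C p.1 p.2).card := Fintype.card_piFinset _
  have hSyspos : (0 : ℝ) < Sys.card := by
    rw [hSyscard, Nat.cast_prod]
    exact Finset.prod_pos fun p _ => by exact_mod_cast (hne p.1 p.2).card_pos
  -- the representative tuple of cell `a` under system `P`
  let diag : (Fin 4 → Fin 3) → (Fin 4 × Fin 3 → σ) → (Fin 4 → σ) := fun a P j => P (j, a j)
  -- (1) every system scores ≤ 54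
  have h1 : ∀ P ∈ Sys, (univ.filter fun a : Fin 4 → Fin 3 => bad (diag a P)).card ≤ 54 := by
    intro P hP
    rw [hSys, Fintype.mem_piFinset] at hP
    exact hsys (fun j b => P (j, b)) (fun j b => hP (j, b))
  have h1s : (∑ P ∈ Sys, ((univ.filter fun a : Fin 4 → Fin 3 => bad (diag a P)).card : ℝ)) ≤
      54 * Sys.card := by
    have := Finset.sum_le_sum h1
    rw [Finset.sum_const, smul_eq_mul] at this
    have h' : ((∑ P ∈ Sys, (univ.filter fun a : Fin 4 → Fin 3 => bad (diag a P)).card : ℕ) : ℝ) ≤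
        ((Sys.card * 54 : ℕ) : ℝ) := by exact_mod_cast this
    push_cast at h'
    linarith
  -- (2) double counting
  have h2 : (∑ P ∈ Sys, (univ.filter fun a : Fin 4 → Fin 3 => bad (diag a P)).card) =
      ∑ a : Fin 4 → Fin 3, (Sys.filter fun P => bad (diag a P)).card :=
    sum_card_filter_comm Sys univ (fun P a => bad (diag a P))
  -- (3) fibres of `diag a` over the cell are off-diagonal products of common size `K a`
  let K : (Fin 4 → Fin 3) → ℕ := fun a => ∏ p : Fin 4 × Fin 3, if p.2 = a p.1 then 1 else (C p.1 p.2).card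
  have hKpos : ∀ a, (0 : ℝ) < K a := by
    intro a
    simp only [K, Nat.cast_prod]
    refine Finset.prod_pos fun p _ => ?_
    split_ifs
    · norm_num
    · exact_mod_cast (hne p.1 p.2).card_pos
  have hfib : ∀ a : Fin 4 → Fin 3, ∀ x ∈ Fintype.piFinset (fun j => C j (a j)),
      (Sys.filter fun P => diag a P = x).card = K a := by
    intro a x hx
    rw [Fintype.mem_piFinset] at hx
    have hset : (Sys.filter fun P => diag a P = x) =
        Fintype.piFinset (fun p : Fin 4 × Fin 3 => if p.2 = a p.1 then {x p.1} else C p.1 p.2) := by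
      ext P
      rw [mem_filter, hSys, Fintype.mem_piFinset, Fintype.mem_piFinset]
      constructor
      · rintro ⟨hP, hd⟩ p
        split_ifs with hp
        · rw [Finset.mem_singleton, ← hd]
          show P p = P (p.1, a p.1)
          rw [← hp]
        · exact hP p
      · intro hP
        refine ⟨fun p => ?_, ?_⟩
        · have := hP p
          split_ifs at this with hp
          · rw [Finset.mem_singleton] at this
            rw [this]
            have := hx p.1
            rw [← hp] at this
            exact this
          · exact this
        · funext j
          have := hP (j, a j)
          simp only [if_true] at this
          simpa using this
    rw [hset, Fintype.card_piFinset]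
    refine Finset.prod_congr rfl fun p _ => ?_
    split_ifs <;> simp
  -- (3a) #Sys = #cell · K,  (3b) #Sys_bad = #cell_bad · K
  have h3a : ∀ a : Fin 4 → Fin 3, (Sys.card : ℝ) = (Fintype.piFinset fun j => C j (a j)).card * K a := by
    intro a
    have h := card_eq_sum_card_fiberwise (f := diag a) (s := Sys)
      (t := Fintype.piFinset fun j => C j (a j)) (by
        intro P hP
        rw [Finset.mem_coe, hSys, Fintype.mem_piFinset] at hP
        rw [Finset.mem_coe, Fintype.mem_piFinset]
        exact fun j => hP (j, a j))
    rw [Finset.sum_congr rfl (hfib a), Finset.sum_const, smul_eq_mul] at h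
    exact_mod_cast h
  have h3b : ∀ a : Fin 4 → Fin 3, ((Sys.filter fun P => bad (diag a P)).card : ℝ) =
      ((Fintype.piFinset fun j => C j (a j)).filter bad).card * K a := by
    intro a
    have h := card_eq_sum_card_fiberwise (f := diag a) (s := Sys.filter fun P => bad (diag a P))
      (t := (Fintype.piFinset fun j => C j (a j)).filter bad) (by
        intro P hP
        rw [Finset.mem_coe, mem_filter, hSys, Fintype.mem_piFinset] at hP
        rw [Finset.mem_coe, mem_filter, Fintype.mem_piFinset]
        exact ⟨fun j => hP.1 (j, a j), hP.2⟩)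
    have hf : ∀ x ∈ (Fintype.piFinset fun j => C j (a j)).filter bad,
        ((Sys.filter fun P => bad (diag a P)).filter fun P => diag a P = x).card = K a := by
      intro x hx
      rw [mem_filter] at hx
      rw [filter_filter]
      rw [← hfib a x hx.1]
      congr 1
      refine filter_congr fun P _ => ⟨fun h => h.2, fun h => ⟨by rw [h]; exact hx.2, h⟩⟩
    rw [Finset.sum_congr rfl hf, Finset.sum_const, smul_eq_mul] at h
    exact_mod_cast h
  -- (4) assemble
  have hcell : ∀ a : Fin 4 → Fin 3, (∏ j, ((C j (a j)).card : ℝ)) =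
      ((Fintype.piFinset fun j => C j (a j)).card : ℝ) := by
    intro a
    rw [Fintype.card_piFinset, Nat.cast_prod]
  have hcellpos : ∀ a : Fin 4 → Fin 3, (0 : ℝ) < ((Fintype.piFinset fun j => C j (a j)).card : ℝ) := by
    intro a
    rw [← hcell]
    exact Finset.prod_pos fun j _ => by exact_mod_cast (hne j (a j)).card_pos
  have hterm : ∀ a : Fin 4 → Fin 3,
      (((Fintype.piFinset fun j => C j (a j)).filter bad).card : ℝ) / ∏ j, ((C j (a j)).card : ℝ) =
        ((Sys.filter fun P => bad (diag a P)).card : ℝ) / Sys.card := by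
    intro a
    rw [hcell a, h3a a, h3b a, mul_div_mul_right _ _ (ne_of_gt (hKpos a))]
  rw [Finset.sum_congr rfl fun a _ => hterm a, ← Finset.sum_div, div_le_iff₀ hSyspos]
  have : (∑ a : Fin 4 → Fin 3, ((Sys.filter fun P => bad (diag a P)).card : ℝ)) =
      ∑ P ∈ Sys, ((univ.filter fun a : Fin 4 → Fin 3 => bad (diag a P)).card : ℝ) := by
    exact_mod_cast h2.symm
  rw [this]
  exact h1s

end Summit.QuantumAdvantage.AdviceFreeQNC0.OddLocal
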